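import Literature.RepresentationTheory.TwistedCoinvariants
import Literature.RepresentationTheory.FixedPointsTraceAverage
import Literature.NumberTheory.Automorphic.SmoothRepresentation
import Mathlib.Topology.Algebra.OpenSubgroup
import HarnessLib

/-!
# `K`-fixed vectors of the twisted coinvariants lift to `K`-fixed vectors, for `K` compact open and a smooth action

Topic `RepresentationTheory`; namespace `Literature.RepresentationTheory.TwistedCoinv` (continuing `TwistedCoinvariants`,
`TwistedCoinvariantsCompactEigenvector`).  KERNEL ONLY: theorems, 0 definitions, 0 named facts, 0 `sorry`.

Setting of `TwistedCoinvariants`: two commuting representations `ρV : Representation k G S`, `ρW : Representation k H S`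
(`hc`), a character `χ : H →* kˣ`, the `χ`-coinvariants `Coinv ρW χ = S ⧸ span {ρW h w - χ h • w}` with the induced
`G`-action `rep χ ρV hc` (`rep g (mk f) = mk (ρV g f)`), `k` a field of characteristic `0`, and a subgroup `K ≤ G`.
The functor of `K`-fixed vectors is EXACT on representations that are smooth along a compact `K` — here the half that
the tree did not yet hold (the other half, «eigenvectors survive in the coinvariants», is
`TwistedCoinvariantsCompactEigenvector`):

* §1 (algebra) **`exists_mem_fixedPoints_mk_eq_of_finiteIndex`** — if every vector of `S` has a stabiliser of finite index
  in `K` along `ρV`, every class `x ∈ Coinv ρW χ` fixed by `rep χ ρV hc (K)` is `mk f` for some `K`-FIXED `f ∈ S`: lift `x`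
  to any `f₀`, and average `f₀` over a transversal of `K ∩ Stab(f₀)` in `K` (the tree's finite averaging operator
  `exists_average_family`, `FixedPointsTraceAverage`); the average is `K`-fixed and has the same class because `x` is
  `K`-fixed.
* §2 (topology) `finiteIndex_inf_stabilizerSubgroup_of_isSmooth` — for `ρV` SMOOTH (open stabilisers,
  `Representation.IsSmooth`) and `K` COMPACT OPEN the finite-index hypothesis holds (open subgroups of a compact group have
  finite index, Mathlib `Subgroup.quotient_finite_of_isOpen`); **`exists_mem_fixedPoints_mk_eq`** — the lift in that
  setting; **`exists_ne_zero_mem_fixedPoints_of_ne_bot`** — if the `K`-fixed classes of `Coinv ρW χ` are not `⊥` then `ρV`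
  has a NON-ZERO `K`-fixed vector.

Consumer: cell `hodgecm-mathlib`, crux H413, ROAD δ (NSI): a `U(diag dV)(𝒪_v)`-spherical line of Liu's local theta type
`X_v(μ, ε, χ)` (the `χ_{1,v}`-coinvariants of the local Weil representation under the centre) lifts to a non-zero
`U(diag dV)(𝒪_v)`-fixed Schwartz–Bruhat function.  Count-neutral; HC_CM is proved only modulo the 7 printed citations
until rung 0 closes.

## References
* [BernsteinZelevinsky1976] I. N. Bernstein, A. V. Zelevinsky, *Representations of the group GL(n, F) where F is a
  non-archimedean local field*, Russian Math. Surveys 31 (1976), §2.1–2.3 (smooth representations of l-groups: for a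
  compact open `K` the functor `V ↦ V^K` is exact, Prop. 2.3∕2.4 circle of ideas).
* [MoeglinVignerasWaldspurger1987] C. Mœglin, M.-F. Vignéras, J.-L. Waldspurger, LNM 1291 (1987), Chap. 2 II.2
  (coinvariants of smooth representations under compact groups).
-/

set_option autoImplicit false

noncomputable section

open scoped BigOperators

namespace Literature.RepresentationTheory.TwistedCoinv

/-! ## §1. Algebra: averaging a lift over a finite transversal -/

section Algebra

variable {k : Type*} [Field k] [CharZero k] {G H S : Type*} [Group G] [Group H] [AddCommGroup S] [Module k S]
  (ρW : Representation k H S) (χ : H →* kˣ) (ρV : Representation k G S)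
  (hc : ∀ (g : G) (h : H), Commute (ρV g) (ρW h))

/-- **`K`-fixed classes of the coinvariants lift to `K`-fixed vectors** (algebraic form): if every vector of `S` has a
stabiliser of finite index in `K` along `ρV`, then every class `x ∈ Coinv ρW χ` fixed by `rep χ ρV hc k`, `k ∈ K`, is the
class of a `K`-fixed vector of `S` (average a lift over a transversal of its stabiliser in `K`).
[cite: BernsteinZelevinsky1976, §2.3] -/
theorem exists_mem_fixedPoints_mk_eq_of_finiteIndex (K : Subgroup G)
    (hfi : ∀ f : S, ((K ⊓ ρV.stabilizerSubgroup f).subgroupOf K).FiniteIndex)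
    {x : Coinv ρW χ} (hx : x ∈ (rep χ ρV hc).fixedPoints K) :
    ∃ f : S, f ∈ ρV.fixedPoints K ∧ mk ρW χ f = x := by
  obtain ⟨f₀, rfl⟩ := mk_surjective ρW χ x
  set K₁ : Subgroup G := K ⊓ ρV.stabilizerSubgroup f₀ with hK₁
  haveI : (K₁.subgroupOf K).FiniteIndex := hfi f₀
  obtain ⟨n, t, hn, htK, _hPid, hPfix⟩ := exists_average_family ρV K K₁
  refine ⟨((n : k)⁻¹ • ∑ i, ρV (t i) : S →ₗ[k] S) f₀, ?_, ?_⟩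
  · rw [Representation.mem_fixedPoints]
    intro g hg
    exact hPfix f₀ (fun g' hg' => (ρV.mem_stabilizerSubgroup f₀ g').1 (Subgroup.mem_inf.1 hg').2) g hg
  · rw [Representation.mem_fixedPoints] at hx
    have hterm : ∀ i, mk ρW χ (ρV (t i) f₀) = mk ρW χ f₀ := fun i => by
      rw [← rep_mk χ ρV hc]; exact hx (t i) (htK i)
    have hn' : (n : k) ≠ 0 := Nat.cast_ne_zero.2 hn
    rw [LinearMap.smul_apply, LinearMap.sum_apply, map_smul, map_sum]
    simp only [hterm, Finset.sum_const, Finset.card_univ, Fintype.card_fin]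
    rw [← Nat.cast_smul_eq_nsmul k, smul_smul, inv_mul_cancel₀ hn', one_smul]

end Algebra

/-! ## §2. Topology: compact open `K`, smooth `ρV` -/

section Topology

variable {k : Type*} [Field k] {G H S : Type*} [Group G] [TopologicalSpace G] [IsTopologicalGroup G]
  [Group H] [AddCommGroup S] [Module k S]
  (ρW : Representation k H S) (χ : H →* kˣ) (ρV : Representation k G S)
  (hc : ∀ (g : G) (h : H), Commute (ρV g) (ρW h))

/-- stabilisers of a SMOOTH representation meet a COMPACT OPEN subgroup `K` in a subgroup of finite index of `K`
(open subgroups of the compact group `K` have finite index). [cite: BernsteinZelevinsky1976, §2.1] -/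
theorem finiteIndex_inf_stabilizerSubgroup_of_isSmooth (hρ : ρV.IsSmooth) (K : Subgroup G)
    (hKo : IsOpen (K : Set G)) (hKc : IsCompact (K : Set G)) (f : S) :
    ((K ⊓ ρV.stabilizerSubgroup f).subgroupOf K).FiniteIndex := by
  haveI : CompactSpace K := isCompact_iff_compactSpace.mp hKc
  have hopen : IsOpen (((K ⊓ ρV.stabilizerSubgroup f).subgroupOf K : Subgroup K) : Set K) := by
    have : (((K ⊓ ρV.stabilizerSubgroup f).subgroupOf K : Subgroup K) : Set K) =
        ((↑) : K → G) ⁻¹' ((K ⊓ ρV.stabilizerSubgroup f : Subgroup G) : Set G) := rfl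
    rw [this, Subgroup.coe_inf]
    exact (hKo.inter (hρ f)).preimage continuous_subtype_val
  haveI : Finite (K ⧸ (K ⊓ ρV.stabilizerSubgroup f).subgroupOf K) := Subgroup.quotient_finite_of_isOpen _ hopen
  exact Subgroup.finiteIndex_of_finite_quotient

variable [CharZero k]

/-- **`K`-fixed classes of the coinvariants lift to `K`-fixed vectors** for `K` compact open and `ρV` smooth: every
`x ∈ Coinv ρW χ` fixed by `rep χ ρV hc (K)` is `mk f` for a `K`-fixed `f ∈ S` (finite averaging over `K ⧸ (K ∩ Stab f₀)` of
any lift `f₀`). [cite: BernsteinZelevinsky1976, §2.3] [cite: MoeglinVignerasWaldspurger1987, Chap. 2 II.2] -/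
theorem exists_mem_fixedPoints_mk_eq (hρ : ρV.IsSmooth) (K : Subgroup G) (hKo : IsOpen (K : Set G))
    (hKc : IsCompact (K : Set G)) {x : Coinv ρW χ} (hx : x ∈ (rep χ ρV hc).fixedPoints K) :
    ∃ f : S, f ∈ ρV.fixedPoints K ∧ mk ρW χ f = x :=
  exists_mem_fixedPoints_mk_eq_of_finiteIndex ρW χ ρV hc K
    (finiteIndex_inf_stabilizerSubgroup_of_isSmooth ρV hρ K hKo hKc) hx

/-- **an unramified coinvariant quotient has a non-zero fixed vector upstairs**: if the `K`-fixed classes of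
`Coinv ρW χ` under `rep χ ρV hc` are not `⊥` (`K` compact open, `ρV` smooth), then `ρV` has a NON-ZERO `K`-fixed vector
(whose class is moreover a non-zero `K`-fixed class). [cite: BernsteinZelevinsky1976, §2.3] -/
theorem exists_ne_zero_mem_fixedPoints_of_ne_bot (hρ : ρV.IsSmooth) (K : Subgroup G) (hKo : IsOpen (K : Set G))
    (hKc : IsCompact (K : Set G)) (h : (rep χ ρV hc).fixedPoints K ≠ ⊥) :
    ∃ f : S, f ≠ 0 ∧ ∀ g ∈ K, ρV g f = f := by
  obtain ⟨x, hx, hx0⟩ := (Submodule.ne_bot_iff _).1 h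
  obtain ⟨f, hf, rfl⟩ := exists_mem_fixedPoints_mk_eq ρW χ ρV hc hρ K hKo hKc hx
  exact ⟨f, fun hf0 => hx0 (by rw [hf0, map_zero]), (Representation.mem_fixedPoints _ _ _).1 hf⟩

end Topology

end Literature.RepresentationTheory.TwistedCoinv

end
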